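import Summits.ResolutionOfSingularities.ResolutionOfSingularities.Theorems.FrobeniusClosingPatchingRelPerfectDepthSNCPointwise
import Literature.AlgebraicGeometry.Resolution.BlowupSNCChartDataRsop
import Literature.AlgebraicGeometry.Resolution.RegularSystemOfParameters
import Literature.AlgebraicGeometry.Resolution.StalkIdealLemmas
import Literature.AlgebraicGeometry.Resolution.SncSaturatedCentre
import HarnessLib

/-!
# Crux EL♮(3) `EquisingularLiftNatThree` (stmt-ResolutionOfSingularities-20148), chain W4.5b — DEAL «ND-K5» brick (B3a),
# part 2: THE POINT STEP OVER THE SECTION — SNC of «fibre :: strict transforms :: exceptional divisor» and the fibre guard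

[OURS · L1 W4.5b · EL♮(3) stmt-ResolutionOfSingularities-20148 · (B3a) `sncInv_init` part 2 · res-type-027 g19 · helper,
`--supports`; def-free; nothing of the manuscript under review [Hironaka2017] is asserted; AI-written, weaker than expert review]

Clauses (c)+(c′) of the candidate invariant `ND.SNCInv₂` (SPEC v7/v8 §13.7 of record, 2026-08-28) at ONE point `y₁` of the
blow-up `τ : X₁ → X` along `C` lying over `V(C)`, from an EXPLICIT regular system of parameters `u₀` of `𝒪_{X,τ y₁}` in which
the centre occupies the positions `S₀`, the members `W̃_i` occupy (injectively) positions `κ i ∈ S₀`, and the head member `K₀`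
(the special fibre) either misses `τ y₁` or occupies a position `t₀ ∉ S₀` (TRANSVERSAL to the centre). Conclusion
(`sncWithAt_cons_comap_transform`): at `y₁`, the family `K₀·𝒪_{X₁} :: St W̃_1 :: ⋯ :: St W̃_m :: [C·𝒪_{X₁}]` has simple normal
crossings, and every tail member through `y₁` has stalk DIFFERENT from that of `K₀·𝒪_{X₁}` (the fibre guard). The proof is the
tree's `exists_snc_labels_of_mem_support` / `IsBlowup.sncWithAt_transform_of_mem_support` run on the chart data
`exists_chartData_of_rsop'` of the GIVEN parameters (`ChartData.stalkIdeal_exceptional` / `…_strictTransform_x` /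
`…_strictTransform_x_self`, `ChartData.exists_rsop`), the head being the TOTAL transform of a transversal member
(`stalkIdeal_comap_eq_map_stalkMap`, `ChartData.algebraMap_reesChartBase`).

References (for the mathematics): J. Kollár, *Lectures on Resolution of Singularities* (2007), Def. 3.25 [Kollar2007];
The Stacks Project, Tag 0804 [StacksProject]; BGMW arXiv:1206.3090 Def. 3.1.1 [BierstoneGrigorievMilmanWlodarczyk2011].
-/

set_option linter.dupNamespace false -- mandated namespace `Summit.<Summit>.<Problem>` of this single-conjunct summit

noncomputable section

open CategoryTheory AlgebraicGeometry TopologicalSpace IsLocalRing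
open Literature.AlgebraicGeometry.Resolution
open Summit.ResolutionOfSingularities.ResolutionOfSingularities.Theorems (DepthSNC.SNCWithAt)

namespace Summit.ResolutionOfSingularities.ResolutionOfSingularities.Cruxes.EquisingularLiftNat.Sections.ND

universe u

variable {X X₁ : Scheme.{u}} [IsLocallyNoetherian X] {τ : X₁ ⟶ X} {C : X.IdealSheafData}

/-- Distinct positions of a regular system of parameters generate distinct principal ideals. [cite: Matsumura1987, Thm. 14.2] -/
theorem eq_of_span_rsop_eq {R : Type*} [CommRing R] [IsRegularLocalRing R] {d : ℕ} (hd : (maximalIdeal R).spanFinrank = d)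
    (v : Fin d → R) (hv : Ideal.span (Set.range v) = maximalIdeal R) {a b : Fin d}
    (hab : Ideal.span {v a} = Ideal.span {v b}) : a = b := by
  by_contra h
  have hmem : v a ∈ Ideal.span (v '' ({b} : Set (Fin d))) := by
    rw [Set.image_singleton, ← hab]; exact Ideal.mem_span_singleton_self _
  exact not_mem_span_image_of_not_mem hd v hv (S := ({b} : Set (Fin d))) (by simpa using h) hmem

/-- **The point step over the centre, with a transversal head.** See the module docstring.
[cite: Kollar2007, Def. 3.25] [cite: StacksProject, Tag 0804] [cite: BierstoneGrigorievMilmanWlodarczyk2011, Def. 3.1.1] -/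
theorem sncWithAt_cons_comap_transform (hτ : IsBlowup τ C) (y₁ : X₁) (hpC : τ y₁ ∈ C.support)
    (hreg : IsRegularLocalRing (X.presheaf.stalk (τ y₁))) {d : ℕ}
    (hsf : (maximalIdeal (X.presheaf.stalk (τ y₁))).spanFinrank = d) (u₀ : Fin d → X.presheaf.stalk (τ y₁))
    (hu₀ : Ideal.span (Set.range u₀) = maximalIdeal (X.presheaf.stalk (τ y₁))) (S₀ : Finset (Fin d))
    (hS₀ : stalkIdeal C (τ y₁) = Ideal.span (u₀ '' (S₀ : Set (Fin d))))
    (K₀ : X.IdealSheafData) (hK₀ : τ y₁ ∉ K₀.support ∨ ∃ t₀, t₀ ∉ S₀ ∧ stalkIdeal K₀ (τ y₁) = Ideal.span {u₀ t₀})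
    {m : ℕ} (Wt : Fin m → X.IdealSheafData) (κ : Fin m → Fin d) (hκ : Function.Injective κ) (hκS : ∀ i, κ i ∈ S₀)
    (hWt : ∀ i, stalkIdeal (Wt i) (τ y₁) = Ideal.span {u₀ (κ i)}) :
    DepthSNC.SNCWithAt (K₀.comap τ :: (List.ofFn (fun i => strictTransformIdeal τ C (Wt i)) ++ [C.comap τ])) ⊤ y₁ ∧
      ∀ D ∈ List.ofFn (fun i => strictTransformIdeal τ C (Wt i)) ++ [C.comap τ],
        y₁ ∈ (K₀.comap τ).support → y₁ ∈ D.support → stalkIdeal D y₁ ≠ stalkIdeal (K₀.comap τ) y₁ := by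
  classical
  haveI := hreg
  haveI : IsProper τ := hτ.isProper
  haveI : IsLocallyNoetherian X₁ := LocallyOfFiniteType.isLocallyNoetherian τ
  obtain ⟨Dc, σ, σ', hσ, hσ', hσS, hσ'S, hσa, hσ'a⟩ := exists_chartData_of_rsop' hτ y₁ hpC hreg hsf u₀ hu₀ S₀ hS₀
  obtain ⟨hregS, d', v, hsf', hspan, lab, hlabinj, hv0, hvw, hve⟩ := Dc.exists_rsop hpC
  letI := Dc.algB
  -- the centre generator attached to `W̃_i`
  have hl : ∀ i, ∃ l, σ l = κ i := fun i => by
    have : κ i ∈ Set.range σ := by rw [hσS]; exact hκS i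
    exact this
  choose l hl using hl
  have hlinj : Function.Injective l := fun i i' h => hκ (by rw [← hl i, ← hl i', h])
  have hWt' : ∀ i, stalkIdeal (Wt i) (τ y₁) = Ideal.span {(X.presheaf.germ Dc.U (τ y₁) Dc.hxU).hom (Dc.x (l i))} := by
    intro i
    obtain ⟨w, hw⟩ := hσa (l i)
    rw [hWt i, ← hl i, ← hw, Ideal.span_singleton_mul_right_unit w.isUnit]
  -- stalks of the strict transforms of the `W̃_i`
  have hSt_top : ∀ i, l i = Dc.i → stalkIdeal (strictTransformIdeal τ C (Wt i)) y₁ = ⊤ := fun i hi =>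
    Dc.stalkIdeal_strictTransform_x_self hpC (Wt i) (by rw [hWt' i, hi])
  have hSt : ∀ i, l i ≠ Dc.i → stalkIdeal (strictTransformIdeal τ C (Wt i)) y₁ = Ideal.span {Dc.toStalk (Dc.gen (l i))} :=
    fun i hi => Dc.stalkIdeal_strictTransform_x hpC (Wt i) hi (hWt' i)
  have hgood : ∀ i, y₁ ∈ (strictTransformIdeal τ C (Wt i)).support → l i ≠ Dc.i ∧ Dc.gen (l i) ∈ Dc.Q := by
    intro i hy
    have hle := (mem_support_iff_stalkIdeal_le _ _).mp hy
    have hi : l i ≠ Dc.i := fun h => by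
      rw [hSt_top i h, top_le_iff] at hle
      exact (maximalIdeal.isMaximal _).ne_top hle
    refine ⟨hi, (Dc.chartGen_mem_Q_iff (l i)).mpr ?_⟩
    rw [hSt i hi, Ideal.span_singleton_le_iff_mem] at hle
    exact hle
  have hSt_v : ∀ i (h : l i ≠ Dc.i ∧ Dc.gen (l i) ∈ Dc.Q),
      stalkIdeal (strictTransformIdeal τ C (Wt i)) y₁ = Ideal.span {v (lab (some (Sum.inr ⟨l i, h⟩)))} := fun i h => by
    rw [hve, hSt i h.1]
  -- the exceptional divisor
  have hE : stalkIdeal (C.comap τ) y₁ = Ideal.span {v (lab none)} := by rw [hv0]; exact Dc.stalkIdeal_exceptional hpC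
  -- the head: total transform of the transversal member
  have hhead : y₁ ∈ (K₀.comap τ).support → ∃ m₀ : Fin Dc.a, stalkIdeal (K₀.comap τ) y₁ = Ideal.span {v (lab (some (Sum.inl m₀)))} := by
    intro hy
    rcases hK₀ with hK₀ | ⟨t₀, ht₀, hK₀⟩
    · exfalso
      rw [Scheme.IdealSheafData.support_comap] at hy
      exact hK₀ hy
    · have ht₀' : t₀ ∈ Set.range σ' := by
        rw [hσ'S, Set.mem_compl_iff, Finset.mem_coe]; exact ht₀
      obtain ⟨m₀, hm₀⟩ := ht₀'
      refine ⟨m₀, ?_⟩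
      obtain ⟨w, hw⟩ := hσ'a m₀
      have hK₀' : stalkIdeal K₀ (τ y₁) = Ideal.span {(X.presheaf.germ Dc.U (τ y₁) Dc.hxU).hom (Dc.w m₀)} := by
        rw [hK₀, ← hm₀, ← hw, Ideal.span_singleton_mul_right_unit w.isUnit]
      rw [stalkIdeal_comap_eq_map_stalkMap, hK₀', Ideal.map_span, Set.image_singleton, hvw, Dc.toStalk_eq,
        Dc.algebraMap_reesChartBase]
  -- the list and its members
  let L : List X₁.IdealSheafData := K₀.comap τ :: (List.ofFn (fun i => strictTransformIdeal τ C (Wt i)) ++ [C.comap τ])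
  have hmem_tail : ∀ D, D ∈ List.ofFn (fun i => strictTransformIdeal τ C (Wt i)) ++ [C.comap τ] ↔
      (∃ i, D = strictTransformIdeal τ C (Wt i)) ∨ D = C.comap τ := by
    intro D
    rw [List.mem_append, List.mem_ofFn, List.mem_singleton]
    constructor
    · rintro (⟨i, h⟩ | h)
      · exact Or.inl ⟨i, h.symm⟩
      · exact Or.inr h
    · rintro (⟨i, h⟩ | h)
      · exact Or.inl ⟨i, h.symm⟩
      · exact Or.inr h
  have hmemL : ∀ D, D ∈ L ↔ D = K₀.comap τ ∨ (∃ i, D = strictTransformIdeal τ C (Wt i)) ∨ D = C.comap τ := by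
    intro D
    rw [List.mem_cons, hmem_tail]
  -- reconstruction of a member from its key
  let recon : Option (Fin Dc.a ⊕ Dc.GoodGen) → X₁.IdealSheafData := fun o =>
    match o with
    | none => C.comap τ
    | some (Sum.inl _) => K₀.comap τ
    | some (Sum.inr g) => if h : ∃ i, l i = g.1 then strictTransformIdeal τ C (Wt h.choose) else C.comap τ
  have hrecon_inr : ∀ i (h : l i ≠ Dc.i ∧ Dc.gen (l i) ∈ Dc.Q),
      recon (some (Sum.inr ⟨l i, h⟩)) = strictTransformIdeal τ C (Wt i) := by
    intro i h
    have hex : ∃ i', l i' = l i := ⟨i, rfl⟩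
    simp only [recon, dif_pos hex]
    rw [hlinj hex.choose_spec]
  -- the key of a member through `y₁`
  have hlabel : ∀ D : {D : X₁.IdealSheafData // D ∈ L ∧ y₁ ∈ D.support},
      ∃ o : Option (Fin Dc.a ⊕ Dc.GoodGen), stalkIdeal D.1 y₁ = Ideal.span {v (lab o)} ∧ recon o = D.1 := by
    rintro ⟨D, hD, hy⟩
    by_cases hDK : D = K₀.comap τ
    · subst hDK
      obtain ⟨m₀, hm₀⟩ := hhead hy
      exact ⟨some (Sum.inl m₀), hm₀, rfl⟩
    rcases (hmemL D).mp hD with h | ⟨i, rfl⟩ | rfl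
    · exact absurd h hDK
    · exact ⟨some (Sum.inr ⟨l i, hgood i hy⟩), hSt_v i (hgood i hy), hrecon_inr i _⟩
    · exact ⟨none, hE, rfl⟩
  choose o ho hrecon using hlabel
  have hv_inj : ∀ {a b : Fin d'}, Ideal.span {v a} = Ideal.span {v b} → a = b := fun hab => eq_of_span_rsop_eq hsf' v hspan hab
  refine ⟨⟨hregS, d', v, hsf', hspan, ⟨fun D => lab (o D), fun D D' hDD' => ?_, ho⟩, fun hy => ?_⟩, ?_⟩
  · exact Subtype.ext ((hrecon D).symm.trans ((congrArg recon (hlabinj hDD')).trans (hrecon D')))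
  · rw [Scheme.IdealSheafData.support_top] at hy
    exact absurd hy id
  · -- the fibre guard: a tail member's key is `none` or `inr _`, the head's is `inl _`
    intro D hD hyK hyD hEq
    obtain ⟨m₀, hm₀⟩ := hhead hyK
    rcases (hmem_tail D).mp hD with ⟨i, rfl⟩ | rfl
    · have h1 := hSt_v i (hgood i hyD)
      rw [hEq, hm₀] at h1
      have := hlabinj (hv_inj h1)
      cases this
    · rw [hEq, hm₀] at hE
      have := hlabinj (hv_inj hE)
      cases this

end Summit.ResolutionOfSingularities.ResolutionOfSingularities.Cruxes.EquisingularLiftNat.Sections.ND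

end
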